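import Mathlib
import Summits.Ventures.PercRepro2.SeriesEdgeEvents
import Summits.Ventures.PercRepro2.ZeroEdges

/-!
# Series reduction, III: the mean field and (HMF) (blind cell PercRepro2, night-1 g9;
NIGHT1-G9.md §8)

`Xhat_series`: the rows `W` and `W ∪ {x}` of `X̂` regroup onto the row `W` of the reduced graph;
`HMFc_series`: every mass of the cleared mean field transports, so `HMFc p ends = HMFc p' ends'`
and **(HMF) is invariant under the series reduction** (`HMF_series_iff`), for marks `≠ x`; the
reduced weights are a probability vector (`isProbVec_p'`).  Composed with `ZeroEdges` (deleting
the two weight-`0` edges): **contraction** — `HMF p ends ↔ HMF` on the graph with `e₁`, `e₂` replaced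
by the single edge `{u, v}` of weight `p e₁ · p e₂` (`HMF_contract_iff`).
-/

namespace Summit.Ventures.PercRepro2

open UnionCluster CovForm

namespace SeriesEdge
section HMF

variable {V : Type*} {E : Type*} [Fintype E] [DecidableEq E] [Fintype V] [DecidableEq V]
  {R : Type*} [Field R] [LinearOrder R] [IsStrictOrderedRing R]

variable (p : E → R) {ends : E → Sym2 V} {e₁ e₂ : E} {u v x : V}
  (he₁ : ends e₁ = s(u, x)) (he₂ : ends e₂ = s(x, v)) (hx : ∀ e, x ∈ ends e → e = e₁ ∨ e = e₂)
  (hne : e₁ ≠ e₂) (hux : u ≠ x) (hvx : v ≠ x)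
include he₁ he₂ hx hne hux hvx

omit [LinearOrder R] [IsStrictOrderedRing R] in
/-- **The mean field `X̂` transports** along the series reduction (all marks `≠ x`): the rows `W`
and `W ∪ {x}` of the original regroup onto the row `W` of the reduced graph. -/
lemma Xhat_series {o a₁ a₂ a₃ b : V} (ho : o ≠ x) (h1 : a₁ ≠ x) (h2 : a₂ ≠ x) (h3 : a₃ ≠ x)
    (hb : b ≠ x) :
    Xhat (p' p e₁ e₂) (ends' ends u v) o a₁ a₂ a₃ b = Xhat p ends o a₁ a₂ a₃ b := by
  rw [Xhat_eq_sum, Xhat_eq_sum]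
  set F : Finset V → R := fun W =>
    prob (p' p e₁ e₂) (clusterEvent (ends' ends u v) a₃ (↑W : Set V)) *
      termW (p' p e₁ e₂) (ends' ends u v) o a₁ a₂ b W with hF
  set G : Finset V → R := fun W =>
    prob p (clusterEvent ends a₃ (↑W : Set V)) * termW p ends o a₁ a₂ b W with hG
  have hL := Finset.sum_filter_add_sum_filter_not Finset.univ (fun W : Finset V => x ∈ W) F
  have hR := Finset.sum_filter_add_sum_filter_not Finset.univ (fun W : Finset V => x ∈ W) G
  -- the rows containing `x` vanish on the reduced side (`x` is isolated there)
  have hL0 : ∑ W ∈ Finset.univ.filter (fun W : Finset V => x ∈ W), F W = 0 := by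
    refine Finset.sum_eq_zero fun W hW => ?_
    simp only [hF, prob_series p hne, preimage_clusterEvent_of_mem he₁ he₂ hx hux hvx h3
      (Finset.mem_coe.2 (Finset.mem_filter.1 hW).2), prob_empty, zero_mul]
  -- a row `W ∌ x` of the reduced side is the rows `W` and `W ∪ {x}` of the original
  have hsplit : ∀ W ∈ Finset.univ.filter (fun W : Finset V => ¬ x ∈ W),
      F W = G W + G (insert x W) := by
    intro W hW
    have hW' : x ∉ W := (Finset.mem_filter.1 hW).2
    have hdisj : Disjoint (clusterEvent ends a₃ (↑W : Set V))
        (clusterEvent ends a₃ (insert x (↑W : Set V))) := by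
      rw [Set.disjoint_left]
      intro ω hω1 hω2
      rw [mem_clusterEvent] at hω1 hω2
      have : x ∈ (↑W : Set V) := by rw [← hω1, hω2]; exact Set.mem_insert x _
      exact hW' (Finset.mem_coe.1 this)
    simp only [hF, hG]
    rw [prob_series p hne, preimage_clusterEvent he₁ he₂ hx hux hvx h3 (Finset.mem_coe.not.2 hW'),
      prob_union_of_disjoint p hdisj, add_mul, ← Finset.coe_insert]
    congr 1
    · rw [termW_series p he₁ he₂ hx hne hux hvx ho h1 h2 hb hW']
    · by_cases huv : u ∈ W ∨ v ∈ W
      · rw [termW_series_insert p he₁ he₂ hx hne hux hvx ho h1 h2 hb hW' huv]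
      · rw [clusterEvent_insert_eq_empty he₁ he₂ hx hux h3 huv, prob_empty, zero_mul, zero_mul]
  -- the rows `W ∋ x` of the original are the rows `W ∪ {x}`, `W ∌ x`
  have hbij : ∑ W ∈ Finset.univ.filter (fun W : Finset V => x ∈ W), G W =
      ∑ W ∈ Finset.univ.filter (fun W : Finset V => ¬ x ∈ W), G (insert x W) := by
    refine Finset.sum_bij' (fun W _ => W.erase x) (fun W' _ => insert x W') ?_ ?_ ?_ ?_ ?_
    · intro W _
      simp only [Finset.mem_filter, Finset.mem_univ, true_and, Finset.mem_erase, ne_eq,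
        not_true_eq_false, false_and, not_false_eq_true]
    · intro W' _
      simp only [Finset.mem_filter, Finset.mem_univ, true_and, Finset.mem_insert, true_or]
    · intro W hW
      exact Finset.insert_erase (Finset.mem_filter.1 hW).2
    · intro W' hW'
      exact Finset.erase_insert (Finset.mem_filter.1 hW').2
    · intro W hW
      rw [Finset.insert_erase (Finset.mem_filter.1 hW).2]
  show ∑ W, F W = ∑ W, G W
  rw [← hL, ← hR, hL0, zero_add, Finset.sum_congr rfl hsplit, Finset.sum_add_distrib, hbij,
    add_comm]

omit [LinearOrder R] [IsStrictOrderedRing R] in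
/-- **The cleared mean field transports along the series reduction** (all marks `≠ x`). -/
theorem HMFc_series {o a₁ a₂ a₃ b : V} (ho : o ≠ x) (h1 : a₁ ≠ x) (h2 : a₂ ≠ x) (h3 : a₃ ≠ x)
    (hb : b ≠ x) :
    HMFc (p' p e₁ e₂) (ends' ends u v) o a₁ a₂ a₃ b = HMFc p ends o a₁ a₂ a₃ b := by
  have hQ : Φ e₁ e₂ ⁻¹' avoidAll (ends' ends u v) a₂ {a₁} = avoidAll ends a₂ {a₁} :=
    preimage_avoidAll he₁ he₂ hx hux hvx h2 (fun y hy => by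
      rw [Finset.mem_singleton] at hy; exact hy ▸ h1)
  have hPD : Φ e₁ e₂ ⁻¹' PDEvent (ends' ends u v) a₁ a₂ a₃ = PDEvent ends a₁ a₂ a₃ :=
    preimage_PDEvent he₁ he₂ hx hux hvx h1 h2 h3
  have hT : Φ e₁ e₂ ⁻¹' TEvent (ends' ends u v) a₁ a₂ a₃ = TEvent ends a₁ a₂ a₃ :=
    preimage_TEvent he₁ he₂ hx hux hvx h1 h2 h3
  have hT' : Φ e₁ e₂ ⁻¹' TEvent (ends' ends u v) a₂ a₁ a₃ = TEvent ends a₂ a₁ a₃ :=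
    preimage_TEvent he₁ he₂ hx hux hvx h2 h1 h3
  have hc1o : Φ e₁ e₂ ⁻¹' connEvent (ends' ends u v) a₁ o = connEvent ends a₁ o :=
    preimage_connEvent he₁ he₂ hx hux hvx h1 ho
  have hc2o : Φ e₁ e₂ ⁻¹' connEvent (ends' ends u v) a₂ o = connEvent ends a₂ o :=
    preimage_connEvent he₁ he₂ hx hux hvx h2 ho
  have hc1b : Φ e₁ e₂ ⁻¹' connEvent (ends' ends u v) a₁ b = connEvent ends a₁ b :=
    preimage_connEvent he₁ he₂ hx hux hvx h1 hb
  have hc2b : Φ e₁ e₂ ⁻¹' connEvent (ends' ends u v) a₂ b = connEvent ends a₂ b :=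
    preimage_connEvent he₁ he₂ hx hux hvx h2 hb
  unfold HMFc CovForm.marginC CovForm.DEF CovForm.EQo CovForm.EQ3 CovForm.EQ3o CovForm.Do massM2
    deltaT CovForm.gap
  simp only [prob_series p hne, Set.preimage_inter, hQ, hPD, hT, hT', hc1o, hc2o, hc1b, hc2b,
    Xhat_series p he₁ he₂ hx hne hux hvx ho h1 h2 h3 hb]

omit [IsStrictOrderedRing R] in
/-- **(HMF) is invariant under the series reduction** (all marks `≠ x`). -/
theorem HMF_series_iff {o a₁ a₂ a₃ b : V} (ho : o ≠ x) (h1 : a₁ ≠ x) (h2 : a₂ ≠ x) (h3 : a₃ ≠ x)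
    (hb : b ≠ x) :
    HMF (p' p e₁ e₂) (ends' ends u v) o a₁ a₂ a₃ b ↔ HMF p ends o a₁ a₂ a₃ b := by
  unfold HMF
  rw [HMFc_series p he₁ he₂ hx hne hux hvx ho h1 h2 h3 hb]

omit [Fintype E] [DecidableEq E] [Fintype V] [DecidableEq V] he₁ he₂ hx hne hux hvx in
/-- The reduced weights form a probability vector. -/
lemma isProbVec_p' [DecidableEq E] (hp : IsProbVec p) : IsProbVec (p' p e₁ e₂) := by
  refine ⟨fun e => ?_, fun e => ?_⟩
  · cases e with
    | none => exact mul_nonneg (hp.nonneg e₁) (hp.nonneg e₂)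
    | some e =>
      rw [p'_some]
      split_ifs
      · exact le_rfl
      · exact hp.nonneg e
  · cases e with
    | none =>
      rw [p'_none]
      exact mul_le_one₀ (hp.le_one e₁) (hp.nonneg e₂) (hp.le_one e₂)
    | some e =>
      rw [p'_some]
      split_ifs
      · exact zero_le_one
      · exact hp.le_one e

end HMF

section Contract

variable {V : Type*} {E : Type*} [Fintype E] [DecidableEq E] [Fintype V] [DecidableEq V]
  {R : Type*} [Field R] [LinearOrder R] [IsStrictOrderedRing R]

/-- The edges kept after the contraction: everything but `e₁` and `e₂`. -/
abbrev keepS (e₁ e₂ : E) : Option E → Prop := fun e => e ≠ some e₁ ∧ e ≠ some e₂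

omit [Fintype E] [Fintype V] [DecidableEq V] [LinearOrder R] [IsStrictOrderedRing R] in
/-- The unkept edges have weight `0`. -/
lemma p'_eq_zero_of_not_keep (p : E → R) (e₁ e₂ : E) :
    ∀ e, ¬ keepS e₁ e₂ e → p' p e₁ e₂ e = 0 := by
  intro e he
  cases e with
  | none => exact absurd ⟨nofun, nofun⟩ he
  | some e =>
    rw [p'_some, if_pos]
    by_contra h
    exact he ⟨fun h' => h (Or.inl (Option.some_injective _ h')),
      fun h' => h (Or.inr (Option.some_injective _ h'))⟩

variable (p : E → R) {ends : E → Sym2 V} {e₁ e₂ : E} {u v x : V}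
  (he₁ : ends e₁ = s(u, x)) (he₂ : ends e₂ = s(x, v)) (hx : ∀ e, x ∈ ends e → e = e₁ ∨ e = e₂)
  (hne : e₁ ≠ e₂) (hux : u ≠ x) (hvx : v ≠ x)
include he₁ he₂ hx hne hux hvx

omit [IsStrictOrderedRing R] in
/-- **Contraction of an unmarked vertex of degree `2`**: `HMF p ends ↔ HMF` on the graph in which
the path `u – x – v` (edges `e₁`, `e₂`) is replaced by the edge `{u, v}` of weight `p e₁ · p e₂`
(the edge type `{e : Option E // e ≠ some e₁ ∧ e ≠ some e₂}`; `x` stays as an isolated vertex). -/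
theorem HMF_contract_iff {o a₁ a₂ a₃ b : V} (ho : o ≠ x) (h1 : a₁ ≠ x) (h2 : a₂ ≠ x) (h3 : a₃ ≠ x)
    (hb : b ≠ x) :
    HMF p ends o a₁ a₂ a₃ b ↔
      HMF (ZeroEdges.pR (keepS e₁ e₂) (p' p e₁ e₂)) (ZeroEdges.endsR (keepS e₁ e₂) (ends' ends u v))
        o a₁ a₂ a₃ b := by
  rw [← HMF_series_iff p he₁ he₂ hx hne hux hvx ho h1 h2 h3 hb]
  exact ZeroEdges.HMF_ext_iff (p' p e₁ e₂) (ends' ends u v) (p'_eq_zero_of_not_keep p e₁ e₂)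
    o a₁ a₂ a₃ b

omit [Fintype E] [Fintype V] [DecidableEq V] he₁ he₂ hx hne hux hvx in
/-- The contracted weights form a probability vector. -/
lemma isProbVec_contract (hp : IsProbVec p) :
    IsProbVec (ZeroEdges.pR (keepS e₁ e₂) (p' p e₁ e₂)) :=
  ZeroEdges.isProbVec_pR (isProbVec_p' p hp)

omit [Fintype E] [DecidableEq E] [Fintype V] [DecidableEq V] [LinearOrder R] [IsStrictOrderedRing R]
  he₂ hne hux hvx in
/-- The star hypothesis transfers to the contracted graph: if every edge at `a₃` is `f₁`, `f₂` or
`e₁` (the case `u = a₃`), every edge at `a₃` of the contracted graph is `f₁`, `f₂` or the new edge. -/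
lemma hstar_contract {f₁ f₂ : E} {a₃ : V}
    (hstar : ∀ e, a₃ ∈ ends e → e = f₁ ∨ e = f₂ ∨ e = e₁) (hf₁ : keepS e₁ e₂ (some f₁))
    (hf₂ : keepS e₁ e₂ (some f₂)) (hn : keepS e₁ e₂ none) :
    ∀ e : {e // keepS e₁ e₂ e}, a₃ ∈ ZeroEdges.endsR (keepS e₁ e₂) (ends' ends u v) e →
      e = ⟨some f₁, hf₁⟩ ∨ e = ⟨some f₂, hf₂⟩ ∨ e = ⟨none, hn⟩ := by
  rintro ⟨e, he⟩ h3
  cases e with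
  | none => exact Or.inr (Or.inr rfl)
  | some e =>
    rcases hstar e h3 with rfl | rfl | rfl
    · exact Or.inl rfl
    · exact Or.inr (Or.inl rfl)
    · exact absurd rfl he.1

omit [Fintype E] [DecidableEq E] [Fintype V] [DecidableEq V] [LinearOrder R] [IsStrictOrderedRing R]
  he₂ hne hux hvx in
/-- The two-edge star hypothesis transfers likewise (every edge at `a₃` is `f₁` or `e₁`). -/
lemma hstar_contract₂ {f₁ : E} {a₃ : V}
    (hstar : ∀ e, a₃ ∈ ends e → e = f₁ ∨ e = e₁) (hf₁ : keepS e₁ e₂ (some f₁))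
    (hn : keepS e₁ e₂ none) :
    ∀ e : {e // keepS e₁ e₂ e}, a₃ ∈ ZeroEdges.endsR (keepS e₁ e₂) (ends' ends u v) e →
      e = ⟨some f₁, hf₁⟩ ∨ e = ⟨none, hn⟩ := by
  rintro ⟨e, he⟩ h3
  cases e with
  | none => exact Or.inr rfl
  | some e =>
    rcases hstar e h3 with rfl | rfl
    · exact Or.inl rfl
    · exact absurd rfl he.1

end Contract

end SeriesEdge

end Summit.Ventures.PercRepro2
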